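import Summits.BirchSwinnertonDyer.BirchSwinnertonDyer.Theorems.ManinLocalTwoThreeKLineSigmaComposition
import Summits.BirchSwinnertonDyer.BirchSwinnertonDyer.Theorems.ManinLocalTwoThreeKLineANKByName
import Summits.BirchSwinnertonDyer.BirchSwinnertonDyer.Theorems.ManinLocalTwoThreeKLineThreeBoundedKSplit
import Summits.BirchSwinnertonDyer.BirchSwinnertonDyer.Theorems.ManinLocalTwoThreeShimuraKernelAtkinLehnerSigns
import Summits.BirchSwinnertonDyer.BirchSwinnertonDyer.Theorems.ManinLocalTwoThreeShimuraQuotientFrickeParity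
import HarnessLib

/-!
# C3 `ManinPrimeToThreeAtNine` ⟸ F₃♮ ∧ CDT-algInt ∧ E-an-221 — the registered skeleton v33 of line `kato_shift_three`, sorry-free: EVERY CELL PIECE IS A THEOREM
(route `ManinLocalTwoThree`, crux C3 stmt-BirchSwinnertonDyer-22968; cell bsd-f2-manin, C3 LEAD p1 gen 17; `--supports stmt-BirchSwinnertonDyer-22968`)

* **`maninPrimeToThreeAtNine_of_katoFactKP_of_CDT_algInt_of_sigmaTorsion : F₃♮ → CDT-algInt → E-an-221 → C3`** — the lead's v30 image
  (`KLineSigma.…_of_kPieces_sigmaTorsion`, p740223) with (BI)_K := p2 g18's `KLineBI.kummerCubeRootThreeBoundedK_holds` (p740441) and (AN♮)_K := p2 g18's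
  `KLine.kummerCubeRootCongruenceOfBoundedKOfUDC_holds` (p741727 = `…_of_minimalCubeRootK` ∘ p3 g16's (INT)_K `MinimalCubeRootC.exists_algInt_minimalCubeRootC`, p741499).
* **`maninPrimeToThreeAtNine_of_katoFactKP_of_CDT_algInt_of_frickeMinus`** — the same with E-an-221 replaced by its HABITAT FORM E-an-221‡ (inline): «lattice-optimal,
  `9 ∣ N`, `frickeEigenvalue f = −1` (root number `+1`), `3 ∣ φ(N/3)`, `Λ₁(f) = ℤ·(3u/c) + 3Λ₀(f)`, `ū + u ∈ Λ_E` ⟹ `E_{W,c}` has a rational point of order 3» (the lead's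
  unconditional cuts `SigmaHabitat.shimuraThreeKernelForcesRationalThreeTorsionAtNine_of_frickeMinus`, p741278; the Atkin–Lehner sign pattern
  `…ShimuraKernelAtkinLehnerSigns` p742140 sharpens the habitat further: exactly one AL-minus prime power `p₀^e`, `3 ∣ φ(p₀^e)`).

So C3 rests on exactly: Kato's `p = 3` divisibility in Kosters–Pannekoek form (PRINTED, statement-only), Calegari–Dimitrov–Tang 2025 with algebraic-integer
coefficients (PRINTED, statement-only), and the cell conjecture E-an-221 on its pinned habitat («a Shimura 3-kernel on an X₀-optimal curve — root number +1, one
AL-minus prime power — forces a rational point of order 3»; prime level = Mazur's Σ/C duality; composite 9 ∣ N not in print, F-an-14).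
HONEST FRAMING.  CONDITIONAL reduction; C3, RES₃♭, Manin's conjecture and BSD are NOT proved.  No definitions, no sorry, no new axioms.
[cite: CalegariDimitrovTang2025, Thm. 1.0.1 and Remarks 58–59] [cite: Kato2004Asterisque, Thm. 9.7 (p. 189)] [cite: AtkinLehner1970, Thm. 3]
-/

set_option autoImplicit false
-- lint-debt: the directory name repeats the summit name (sibling precedent `ManinLocalTwoThreeKLineSigmaComposition.lean`)
set_option linter.dupNamespace false

noncomputable section

open scoped ComplexConjugate
open WeierstrassCurve Literature.NumberTheory.EllipticCurves Literature.NumberTheory.EllipticCurves.ModularForms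
open Summit.BirchSwinnertonDyer.Rank1Residual.ManinAdditive.CuspidalKummerThree
open Summit.BirchSwinnertonDyer.Rank1Residual.ManinAdditive.UDCKummerLineK
open Summit.BirchSwinnertonDyer.Rank1Residual.ManinAdditive.ShimuraThreeTorsion

namespace Summit.BirchSwinnertonDyer.BirchSwinnertonDyer.Theorems.ManinLocalTwoThree.KLineSigma

/-- **C3 ⟸ F₃♮ ∧ CDT-algInt ∧ E-an-221 — skeleton v33, sorry-free; every cell piece of the line is a theorem by name.**  CONDITIONAL reduction;
C3 is NOT proved; BSD is NOT proved by this. [cite: Kato2004Asterisque, Thm. 9.7 (p. 189)] [cite: CalegariDimitrovTang2025, Thm. 1.0.1 and Remarks 58–59] -/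
theorem maninPrimeToThreeAtNine_of_katoFactKP_of_CDT_algInt_of_sigmaTorsion
    (hK : kato_neron_isIntegral_twistedSymbolSum_of_additive_three_kp)
    (hCDT : Literature.NumberTheory.Automorphic.CalegariDimitrovTang2025_unboundedDenominators_algInt)
    (h221 : ShimuraThreeKernelForcesRationalThreeTorsionAtNine) :
    Summit.BirchSwinnertonDyer.BirchSwinnertonDyer.Theses.ManinLocalTwoThree.ManinPrimeToThreeAtNine :=
  maninPrimeToThreeAtNine_of_katoFactKP_of_CDT_algInt_of_kPieces_sigmaTorsion hK hCDT KLineBI.kummerCubeRootThreeBoundedK_holds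
    KLine.kummerCubeRootCongruenceOfBoundedKOfUDC_holds h221

/-- **C3 ⟸ F₃♮ ∧ CDT-algInt ∧ E-an-221‡ (the habitat form)**: the conjecture is needed only for lattice-optimal data at `9 ∣ N` with Fricke sign `ε(f) = −1`
(root number `+1`), `3 ∣ φ(N/3)`, and a third-period `u` whose line IS the `Γ₁(N)`-period lattice (`Λ₁(f) = ℤ·(3u/c) + 3Λ₀(f)`) and which is imaginary
(`ū + u ∈ Λ_E`).  CONDITIONAL reduction; C3 is NOT proved; BSD is NOT proved by this. [cite: AtkinLehner1970, Thm. 3] [cite: Kato2004Asterisque, Thm. 9.7 (p. 189)] -/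
theorem maninPrimeToThreeAtNine_of_katoFactKP_of_CDT_algInt_of_frickeMinus
    (hK : kato_neron_isIntegral_twistedSymbolSum_of_additive_three_kp)
    (hCDT : Literature.NumberTheory.Automorphic.CalegariDimitrovTang2025_unboundedDenominators_algInt)
    (h221 : ∀ (W : WeierstrassCurve ℚ) [W.IsElliptic] [W.IsGloballyMinimal] {N : ℕ} [NeZero N]
      (D : ModularParametrizationData W N),
      (∀ z ∈ D.L.lattice, ∃ w ∈ periodLattice D.f, z = D.c * w) → 3 ^ 2 ∣ N → frickeEigenvalue D.f = -1 → 3 ∣ Nat.totient (N / 3) →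
      ∀ u : ℂ, 3 * u ∈ D.L.lattice →
      (∀ z : ℂ, z ∈ periodLatticeGamma1 D.f ↔ ∃ k : ℤ, ∃ v ∈ periodLattice D.f, z = k * (3 * u / D.c) + 3 * v) →
      conj u + u ∈ D.L.lattice →
      ∃ X Y : ℚ, IsShortThreeTorsion W D.c X Y) :
    Summit.BirchSwinnertonDyer.BirchSwinnertonDyer.Theses.ManinLocalTwoThree.ManinPrimeToThreeAtNine :=
  maninPrimeToThreeAtNine_of_katoFactKP_of_CDT_algInt_of_sigmaTorsion hK hCDT
    (SigmaHabitat.shimuraThreeKernelForcesRationalThreeTorsionAtNine_of_frickeMinus h221)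

end Summit.BirchSwinnertonDyer.BirchSwinnertonDyer.Theorems.ManinLocalTwoThree.KLineSigma

end
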